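import Summits.AtomisticToContinuum.Crystallization.Theorems.OverbindingBudgetBalancedCensusStatements

/-!
# OverbindingBudget — the misfit census BALANCED against the chunk's own stress, II: the glue re-proved and the cones
# (decomp-a2c lens-4, generation 40)

Helper file (`--supports stmt-AtomisticToContinuum-31280`).  Part I (`…BalancedCensusStatements`) typed the balanced census family and proved
the seams `RSG ⇒ TameBalancedDeepScaleGap ⇒[shape] TameBalancedScaleGap ⇒[gap-free] TameBalancedMisfitGap`.  This part re-proves the glue of
cone XLI-W with the STRESS REBATE absorbed:

  `misfitRelax_of_tameBalancedMisfitGap : 0 ≤ a → a ≤ 1 → TameBalancedMisfitGap a 0 → MisfitRelax a`.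

The proof is `…MisfitWindow.misfitRelax_of_tameMisfitGap` (g37/g39: grid density of margin-`0` violators, locality two units inside the cube,
sparse charge, `crysEnergyLimit`, packing, the off-window boundary layer) with three changes, all in the final accounting:
(1) SEVEN budget items `κℓ³`, `κ := c/(56 s³)` (the stress rebate is the new one, of size `2κℓ³`);
(2) the output rate is `κ' := κ/(2C₁)`, `C₁ := C⁺ + 1`, and `crysEnergyLimit` is invoked at accuracy `ε := κ'/B`;
(3) a CASE SPLIT on the chunk `F = Y ∩ cube(ℓ)`: if `C⁺·(dilGain y + shGain u y) ≤ 2κℓ³` the census prices the chunk as before; otherwise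
    `dilGain y > 2κ'ℓ³` or `shGain u y > 2κ'ℓ³`, and the chunk is strained OUTRIGHT by the cell's proved competitor bounds
    `E(N) + dilGain y ≤ 𝓔(y)` (`…ElasticSplitDilation`, exact homothety identity) resp. `N e⋆ + shGain u y ≤ 𝓔(y)`
    (`…ElasticSplitShear` ← `ContactSaturationLadderDirectionalCharge.directionalCharge_le`) and `E(N) ≤ N(e⋆ + ε)`.

The cones (CONE XLV and its record instance) are in part III (`…BalancedCensusCones`).

Reading (lens «minimal counterexample»): a minimal counterexample to the census may be taken STRESS-FREE (all mean virial-stress components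
`o(ℓ³)` on the chunk), `ρ`-DEEP (every priced site has a fully registered `ρ·nn`-ball, any `ρ`) and WINDOWED (`nn ∈ [δ, 2]`); no homogeneous
(affinely strained Barlow) configuration is priced by the new leaf.
-/

namespace Summit.AtomisticToContinuum.Crystallization.Theorems.OverbindingBudgetBalancedCensus

open Filter Metric Set Topology
open scoped BigOperators
open Literature.MathematicalPhysics.StatisticalMechanics
open Literature.Geometry.DiscreteGeometry (IsChargeFree bondGraph nearestDist nearestDist_le_dist nearestDist_nonneg le_nearestDist bondGraph_adj)
open Summit.AtomisticToContinuum.Crystallization.Theorems.OverbindingBudgetViolatorDensityFloor (RT)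
open Summit.AtomisticToContinuum.Crystallization.Theorems.OverbindingBudgetRecurrentDustStatements (ViolatorsL rt_mono window_finite
  window_finite_lt)
open Summit.AtomisticToContinuum.Crystallization.Theorems.OverbindingBudgetBindingSignLaw (grid_lower_bound)
open Summit.AtomisticToContinuum.Crystallization.Theorems.OverbindingBudgetExcessInstability (finite_inter_cube)
open Summit.AtomisticToContinuum.Crystallization.Theorems.OverbindingBudgetEdgeRelaxationStatements (CleanClass StrainedCubes)
open Summit.AtomisticToContinuum.Crystallization.Theorems.OverbindingBudgetElasticSplitStatements (chargedCount DenseCharge SparseCharge)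
open Summit.AtomisticToContinuum.Crystallization.Theorems.OverbindingBudgetElasticSplitPricing (rpow_two_thirds_le
  two_mul_interactionEnergy_eq_sum_sum_image groundStateEnergy_le_eventually)
open Summit.AtomisticToContinuum.Crystallization.Theorems.OverbindingBudgetMisfitCensusStatements (Bad Short Long Gap badCount scaleCount
  gapCount MisfitEnergyGap ScaleEnergyGap GapEnergyGap GapFreeShells bad_cases badCount_le_scaleCount_add_gapCount
  badCount_le_scaleCount_of_gapFree rt_of_local card_le_of_cube MisfitRelax)
open Summit.AtomisticToContinuum.Crystallization.Theorems.OverbindingBudgetMisfitRegistration (Framed Reg DeepReg NearCharge regScaleCount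
  unregCount nearChargeCount RegisteredScaleGap nearCharge_of_not_framed nearCharge_of_not_deepReg)
open Summit.AtomisticToContinuum.Crystallization.Theorems.OverbindingBudgetTwoShellShape (TwoShellShape)
open Summit.AtomisticToContinuum.Crystallization.Theorems.OverbindingBudgetMisfitWindowStatements (InWindow offCount rimCount ScaleEnergyGapW
  MisfitEnergyGapW GapEnergyGapW TameScaleGap TameMisfitGap)
open Summit.AtomisticToContinuum.Crystallization.Theorems.OverbindingBudgetMisfitWindowLayer (offCount_chunk_le)
open Summit.AtomisticToContinuum.Crystallization.Theorems.OverbindingBudgetBalancedCensusStatements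

/-! ## §G  The glue with the window AND the stress rebate absorbed (PROVED) -/

set_option maxHeartbeats 800000 in
/-- **The glue: `TameBalancedMisfitGap a 0 → MisfitRelax a`** (`0 ≤ a ≤ 1`).  As `…MisfitWindow.misfitRelax_of_tameMisfitGap`, with the census
instantiated at the window `[min δ 2, 2]`, SEVEN `κℓ³` budget items (`κ := c/(56 s³)`), output rate `κ' = κ/(2(C⁺ + 1))`, and the final case
split: a chunk whose stress gain exceeds `2κℓ³/C⁺` is strained by `groundStateEnergy_add_dilGain_le` / `floor_add_shGain_le` directly. [this file] -/
theorem misfitRelax_of_tameBalancedMisfitGap {a : ℝ} (ha0 : 0 ≤ a) (ha1 : a ≤ 1) (hM : TameBalancedMisfitGap a 0) :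
    MisfitRelax a := by
  classical
  intro Y hUD hcov hSp t ht L hV
  have hUD' := hUD
  obtain ⟨δ₀, hδ₀, hsep₀⟩ := hUD'
  -- the separation constant, capped at `2`
  set δ : ℝ := min δ₀ 2 with hδdef
  have hδ : 0 < δ := lt_min hδ₀ two_pos
  have hδ2 : δ ≤ 2 := min_le_right _ _
  have hsep : ∀ z ∈ Y, ∀ w ∈ Y, z ≠ w → δ ≤ dist z w := fun z hz w hw hzw => (min_le_left _ _).trans (hsep₀ z hz w hw hzw)
  clear_value δ
  obtain ⟨c, C, hc, hgap⟩ := hM δ hδ hδ2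
  set e : ℝ := ⨅ Q : PeriodicConfiguration 3, Q.energyPerParticle lennardJones with he
  -- the grid scale
  set L' : ℝ := max L 0 with hL'
  set s : ℝ := 2 * L' + 2 with hs
  have hL'0 : 0 ≤ L' := le_max_right L 0
  have hs2 : 2 ≤ s := by rw [hs]; linarith
  have hs0 : 0 < s := by linarith
  -- the violator indicator is heavy at scale `s`
  set g : EuclideanSpace ℝ (Fin 3) → ℝ := fun y => if RT a 0 Y y then 0 else 1 with hg
  have hg0 : ∀ y ∈ Y, (0 : ℝ) ≤ g y := by
    intro y _
    simp only [hg]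
    split_ifs <;> norm_num
  have hheavy : ∀ z : EuclideanSpace ℝ (Fin 3), ∃ q ∈ Y, dist q z < s / 2 ∧ (1 : ℝ) ≤ g q := by
    intro z
    obtain ⟨w, hw, hzw⟩ := hcov z
    obtain ⟨y, hy, hyw, hviol⟩ := hV w hw
    refine ⟨y, hy, ?_, ?_⟩
    · calc dist y z ≤ dist y w + dist w z := dist_triangle _ _ _
        _ < s / 2 := by rw [dist_comm w z, hs]; linarith [le_max_left L 0]
    · have hv : ¬ RT a 0 Y y := fun h0 =>
        hviol (t / 2) (by linarith) (by linarith) (rt_mono hUD (by linarith) h0)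
      simp only [hg, if_neg hv, le_refl]
  -- constants
  set B : ℝ := 27 / δ ^ 3 with hB
  have hBpos : 0 < B := by positivity
  -- the boundary-layer constant: `#layer ≤ Λ ℓ²`
  set Λ : ℝ := 54 * (4 / δ + 1) / δ ^ 2 with hΛ
  have hΛpos : 0 < Λ := by positivity
  set Cp : ℝ := max C 0 with hCp
  have hCp0 : 0 ≤ Cp := le_max_right _ _
  have hCle : C ≤ Cp := le_max_left _ _
  -- ### NEW (g40): a positive cap `C₁ ≥ C⁺` for the output rate, seven budget items, output rate `κ' = κ/(2C₁)`
  set C₁ : ℝ := Cp + 1 with hC₁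
  have hC₁pos : 0 < C₁ := by positivity
  have hCpC₁ : Cp ≤ C₁ := by rw [hC₁]; linarith
  set κ : ℝ := c / (56 * s ^ 3) with hκ
  have hκpos : 0 < κ := by positivity
  set κ' : ℝ := κ / (2 * C₁) with hκ'
  have hκ'pos : 0 < κ' := by positivity
  have hκC : κ = 2 * C₁ * κ' := by
    rw [hκ']
    field_simp
  have hκ'le : κ' ≤ κ := by
    rw [hκC]
    have : 0 ≤ (2 * C₁ - 1) * κ' := mul_nonneg (by linarith) hκ'pos.le
    nlinarith
  set ε : ℝ := κ' / B with hε
  have hεpos : 0 < ε := by positivity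
  obtain ⟨N₁, -, hN₁⟩ := groundStateEnergy_le_eventually hεpos
  rw [← he] at hN₁
  have hcCp : 0 < c + Cp := by linarith
  set ρ : ℝ := κ / (c + Cp) with hρ
  have hρpos : 0 < ρ := by positivity
  set M : ℝ := Cp * B / κ + 1 with hM
  have hMpos : 0 < M := by positivity
  set Mo : ℝ := Cp * Λ / κ with hMo
  have hMo0 : 0 ≤ Mo := by positivity
  -- sparse charge at density `ρ`
  have hSρ := hSp ρ hρpos
  unfold DenseCharge at hSρ
  push Not at hSρ
  obtain ⟨ℓc, hℓc⟩ := hSρ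
  refine ⟨κ', hκ'pos, ?_⟩
  intro ℓ₀
  -- the side `ℓ = n s + 4`, `n` large
  obtain ⟨n, hn⟩ := exists_nat_ge (max (max (max (max ℓ₀ ℓc) (max (N₁ : ℝ) M)) (max 2 δ)) Mo)
  simp only [max_le_iff] at hn
  obtain ⟨⟨⟨⟨hnℓ₀, hnℓc⟩, hnN₁, hnM⟩, hn2, hnδ⟩, hnMo⟩ := hn
  have hn1 : (1 : ℝ) ≤ n := by linarith
  have hns : (n : ℝ) ≤ n * s := le_mul_of_one_le_right (by linarith) (by linarith)
  have hns4 : (4 : ℝ) ≤ n * s := by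
    have h := mul_le_mul hn2 hs2 (by norm_num) (by linarith : (0 : ℝ) ≤ n)
    linarith
  set ℓ : ℝ := n * s + 4 with hℓ
  have hℓns : ℓ ≤ 2 * (n * s) := by rw [hℓ]; linarith
  have hℓpos : 0 < ℓ := by rw [hℓ]; linarith
  have hℓ₀ℓ : ℓ₀ ≤ ℓ := by rw [hℓ]; linarith
  have hℓcℓ : ℓc ≤ ℓ := by rw [hℓ]; linarith
  have hℓδ : δ ≤ ℓ := by rw [hℓ]; linarith
  have hℓMo : Mo ≤ ℓ := by rw [hℓ]; linarith
  -- outer corner `o = (-2,-2,-2)`, inner corner `0`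
  set o : EuclideanSpace ℝ (Fin 3) := WithLp.toLp 2 (fun _ : Fin 3 => (-2 : ℝ)) with ho
  have hoi : ∀ i : Fin 3, o i = -2 := fun i => rfl
  have h0i : ∀ i : Fin 3, (0 : EuclideanSpace ℝ (Fin 3)) i = 0 := fun i => rfl
  clear_value L' s B Λ Cp C₁ κ κ' ε ρ M Mo ℓ o e g
  -- the chunk, enumerated
  have hfin : (Y ∩ {z | ∀ i : Fin 3, o i ≤ z i ∧ z i < o i + ℓ}).Finite := finite_inter_cube hUD o hℓpos.le
  obtain ⟨N, y, hy, hr⟩ := hfin.fin_param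
  set F : Finset (EuclideanSpace ℝ (Fin 3)) := Finset.univ.image y with hF
  have hFcoe : (↑F : Set (EuclideanSpace ℝ (Fin 3))) = Y ∩ {z | ∀ i : Fin 3, o i ≤ z i ∧ z i < o i + ℓ} := by
    rw [hF, Finset.coe_image, Finset.coe_univ, Set.image_univ, hr]
  have hFcard : F.card = N := by
    rw [hF, Finset.card_image_of_injective _ hy, Finset.card_univ, Fintype.card_fin]
  have hmem : ∀ z ∈ F, z ∈ Y ∧ ∀ i : Fin 3, o i ≤ z i ∧ z i < o i + ℓ := by
    intro z hz
    have hz' : z ∈ (↑F : Set (EuclideanSpace ℝ (Fin 3))) := hz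
    rw [hFcoe] at hz'
    exact hz'
  have hU : 1 / 2 * ∑ x ∈ F, ∑ z ∈ F, lennardJones (dist x z) = interactionEnergy lennardJones y := by
    have h2 := two_mul_interactionEnergy_eq_sum_sum_image hy
    rw [← hF] at h2
    linarith
  -- the inner chunk
  set Fi : Finset (EuclideanSpace ℝ (Fin 3)) :=
    F.filter (fun z => ∀ i : Fin 3, (0 : EuclideanSpace ℝ (Fin 3)) i ≤ z i ∧ z i < (0 : EuclideanSpace ℝ (Fin 3)) i + n * s) with hFi
  have hFicoe : (↑Fi : Set (EuclideanSpace ℝ (Fin 3))) =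
      Y ∩ {z | ∀ i : Fin 3, (0 : EuclideanSpace ℝ (Fin 3)) i ≤ z i ∧ z i < (0 : EuclideanSpace ℝ (Fin 3)) i + n * s} := by
    ext z
    simp only [hFi, Finset.coe_filter, Set.mem_setOf_eq, Set.mem_inter_iff]
    constructor
    · rintro ⟨hzF, hzi⟩
      exact ⟨(hmem z hzF).1, hzi⟩
    · rintro ⟨hzY, hzi⟩
      refine ⟨?_, hzi⟩
      have hzF : z ∈ (↑F : Set (EuclideanSpace ℝ (Fin 3))) := by
        rw [hFcoe]
        refine ⟨hzY, fun i => ?_⟩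
        have h := hzi i
        rw [h0i] at h
        rw [hoi, hℓ]
        constructor <;> linarith [h.1, h.2]
      exact hzF
  clear_value F Fi
  -- violators of `Y` two units inside the cube are BAD or CHARGED in the chunk's own census: at least `n³` of them
  have hviol : (n : ℝ) ^ 3 ≤ (badCount a 0 y : ℝ) + (chargedCount y : ℝ) := by
    have hgrid : (n : ℝ) ^ 3 * 1 ≤ ∑ z ∈ Fi, g z := grid_lower_bound g hg0 hs0 hheavy n 0 Fi hFicoe
    have hsum : ∑ z ∈ Fi, g z = (((Fi.filter (fun z => ¬ RT a 0 Y z)).card : ℕ) : ℝ) := by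
      rw [Finset.card_filter]
      push_cast
      refine Finset.sum_congr rfl (fun z _ => ?_)
      by_cases h : RT a 0 Y z <;> simp [hg, h]
    -- locality: a violator of `Y` two units inside the cube is a violator of the chunk
    have hviolF : (Fi.filter (fun z => ¬ RT a 0 Y z)).card ≤
        (Finset.univ.filter (fun i : Fin N => ¬ RT a 0 (Set.range y) (y i))).card := by
      calc (Fi.filter (fun z => ¬ RT a 0 Y z)).card
          ≤ ((Finset.univ.filter (fun i : Fin N => ¬ RT a 0 (Set.range y) (y i))).image y).card := by
            apply Finset.card_le_card
            intro z hz
            rw [Finset.mem_filter] at hz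
            obtain ⟨hzFi, hzv⟩ := hz
            rw [hFi, Finset.mem_filter] at hzFi
            obtain ⟨hzF, hzin⟩ := hzFi
            rw [hF, Finset.mem_image] at hzF
            obtain ⟨i, -, rfl⟩ := hzF
            refine Finset.mem_image.2 ⟨i, Finset.mem_filter.2 ⟨Finset.mem_univ _, fun hRT => hzv ?_⟩, rfl⟩
            refine rt_of_local hUD (by rw [hr]; exact Set.inter_subset_left) (fun w hw hd => ?_) ha0 hRT
            rw [hr]
            refine ⟨hw, fun k => ?_⟩
            have hk : |(y i) k - w k| ≤ dist (y i) w := by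
              rw [← Real.dist_eq]
              exact PiLp.dist_apply_le (y i) w k
            have hd2 : dist (y i) w < 2 := by linarith
            have hzk := hzin k
            rw [h0i] at hzk
            rw [hoi, hℓ]
            have habs := abs_lt.1 (lt_of_le_of_lt hk hd2)
            constructor <;> linarith [habs.1, habs.2, hzk.1, hzk.2]
        _ ≤ _ := Finset.card_image_le
    -- census: a violator of the chunk is bad or charged
    have hsplit : (Finset.univ.filter (fun i : Fin N => ¬ RT a 0 (Set.range y) (y i))).card ≤ badCount a 0 y + chargedCount y := by
      simp only [badCount, chargedCount, Nat.card_eq_fintype_card, Fintype.card_subtype]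
      calc (Finset.univ.filter (fun i : Fin N => ¬ RT a 0 (Set.range y) (y i))).card
          ≤ ((Finset.univ.filter fun i => Bad a 0 y i) ∪ (Finset.univ.filter fun i => ¬ IsChargeFree (1 / 100 : ℝ) y i)).card := by
            apply Finset.card_le_card
            intro i hi
            rw [Finset.mem_filter] at hi
            rw [Finset.mem_union, Finset.mem_filter, Finset.mem_filter]
            by_cases hcf : IsChargeFree (1 / 100 : ℝ) y i
            · exact Or.inl ⟨hi.1, hcf, hi.2⟩
            · exact Or.inr ⟨hi.1, hcf⟩
        _ ≤ _ := Finset.card_union_le _ _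
    have h1 : (n : ℝ) ^ 3 ≤ (((Fi.filter (fun z => ¬ RT a 0 Y z)).card : ℕ) : ℝ) := by linarith [hgrid, hsum]
    have h2 : (((Fi.filter (fun z => ¬ RT a 0 Y z)).card : ℕ) : ℝ) ≤ (badCount a 0 y : ℝ) + (chargedCount y : ℝ) := by
      exact_mod_cast hviolF.trans hsplit
    linarith
  -- bad and charged sites are disjoint: `#bad + #charged ≤ N`
  have hsumN : (badCount a 0 y : ℝ) + (chargedCount y : ℝ) ≤ N := by
    have h : badCount a 0 y + chargedCount y ≤ N := by
      simp only [badCount, chargedCount, Nat.card_eq_fintype_card, Fintype.card_subtype]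
      have h1 : (Finset.univ.filter fun i : Fin N => Bad a 0 y i).card ≤
          (Finset.univ.filter fun i : Fin N => IsChargeFree (1 / 100 : ℝ) y i).card :=
        Finset.card_le_card fun i hi => by
          rw [Finset.mem_filter] at hi ⊢
          exact ⟨hi.1, hi.2.1⟩
      have h2 := Finset.card_filter_add_card_filter_not (s := (Finset.univ : Finset (Fin N)))
        (fun i : Fin N => IsChargeFree (1 / 100 : ℝ) y i)
      rw [Finset.card_univ, Fintype.card_fin] at h2
      omega
    exact_mod_cast h
  -- counts
  have hcc : (chargedCount y : ℝ) < ρ * ℓ ^ 3 := hℓc ℓ hℓcℓ o N y hy hr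
  have hccN : (chargedCount y : ℝ) ≤ N := by
    have h1 : chargedCount y ≤ Nat.card (Fin N) := Finite.card_subtype_le _
    rw [Nat.card_eq_fintype_card, Fintype.card_fin] at h1
    exact_mod_cast h1
  have hbadN : (badCount a 0 y : ℝ) ≤ N := by
    have h1 : badCount a 0 y ≤ Nat.card (Fin N) := Finite.card_subtype_le _
    rw [Nat.card_eq_fintype_card, Fintype.card_fin] at h1
    exact_mod_cast h1
  have hNn : (n : ℝ) ^ 3 ≤ N := hviol.trans hsumN
  have hNB : (N : ℝ) ≤ B * ℓ ^ 3 := by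
    rw [← hFcard, hB]
    exact card_le_of_cube hδ hℓδ (fun z hz => (hmem z hz).2) (fun z hz w hw hzw => hsep z (hmem z hz).1 w (hmem w hw).1 hzw)
  have hnn3 : (n : ℝ) ≤ (n : ℝ) ^ 3 := le_self_pow₀ hn1 (by norm_num)
  have hN₁N : N₁ ≤ N := by exact_mod_cast hnN₁.trans (hnn3.trans hNn)
  have hNM : M ^ 3 ≤ (N : ℝ) := (pow_le_pow_left₀ hMpos.le hnM 3).trans hNn
  -- ### NEW (g39): the off-window sites of the chunk lie in its boundary layer, `#off ≤ Λ ℓ²` (part 2, `offCount_chunk_le`)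
  have hN2 : 2 ≤ N := by
    have h8 : (2 : ℝ) ^ 3 ≤ (n : ℝ) ^ 3 := pow_le_pow_left₀ (by norm_num) hn2 3
    have h2 : (2 : ℝ) ≤ N := by linarith [hNn]
    exact_mod_cast h2
  have hoffN : (offCount δ 2 y : ℝ) ≤ Λ * ℓ ^ 2 := by
    rw [hΛ]
    exact offCount_chunk_le (m := (n : ℝ) * s) hδ hℓδ hsep hcov hoi hℓ hy hr hN2
  -- the two energy bounds
  have hE : groundStateEnergy lennardJones 3 N ≤ (e + ε) * N := hN₁ N hN₁N
  -- ### NEW (g40): the census picks a unit direction `u`; its inequality carries the stress rebate `C·(dilGain y + shGain u y)`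
  obtain ⟨u, hu, hG⟩ := hgap N y hy
  -- error terms
  have hN0 : (0 : ℝ) ≤ N := Nat.cast_nonneg N
  have hrpow : (N : ℝ) ^ (2 / 3 : ℝ) ≤ N / M := rpow_two_thirds_le hMpos hNM
  have hrpow0 : 0 ≤ (N : ℝ) ^ (2 / 3 : ℝ) := Real.rpow_nonneg hN0 _
  have hcc0 : (0 : ℝ) ≤ chargedCount y := Nat.cast_nonneg _
  have herr0 : C * (chargedCount y : ℝ) ≤ Cp * (chargedCount y : ℝ) := mul_le_mul_of_nonneg_right hCle hcc0
  have herr1 : C * (N : ℝ) ^ (2 / 3 : ℝ) ≤ κ * ℓ ^ 3 := by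
    have h1 : C * (N : ℝ) ^ (2 / 3 : ℝ) ≤ Cp * (N : ℝ) ^ (2 / 3 : ℝ) := mul_le_mul_of_nonneg_right hCle hrpow0
    have h2 : Cp * (N : ℝ) ^ (2 / 3 : ℝ) ≤ Cp * (N / M) := mul_le_mul_of_nonneg_left hrpow hCp0
    have h3 : Cp * (N / M) ≤ Cp * (B * ℓ ^ 3 / M) :=
      mul_le_mul_of_nonneg_left (div_le_div_of_nonneg_right hNB hMpos.le) hCp0
    have h4 : Cp * (B * ℓ ^ 3 / M) ≤ κ * ℓ ^ 3 := by
      have h5 : Cp * B ≤ κ * M := by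
        rw [hM, mul_add, mul_div_cancel₀ _ (ne_of_gt hκpos)]
        linarith
      have hl3 : 0 ≤ ℓ ^ 3 := by positivity
      rw [show Cp * (B * ℓ ^ 3 / M) = Cp * B / M * ℓ ^ 3 by field_simp]
      apply mul_le_mul_of_nonneg_right _ hl3
      rw [div_le_iff₀ hMpos]
      linarith
    linarith
  have herr2 : ε * N ≤ κ' * ℓ ^ 3 := by
    have h1 : ε * N ≤ ε * (B * ℓ ^ 3) := mul_le_mul_of_nonneg_left hNB hεpos.le
    have h2 : ε * (B * ℓ ^ 3) = κ' * ℓ ^ 3 := by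
      rw [hε]
      field_simp
    linarith
  have herr3 : (c + Cp) * (chargedCount y : ℝ) ≤ κ * ℓ ^ 3 := by
    have h1 : (c + Cp) * (chargedCount y : ℝ) ≤ (c + Cp) * (ρ * ℓ ^ 3) := mul_le_mul_of_nonneg_left hcc.le hcCp.le
    have h2 : (c + Cp) * (ρ * ℓ ^ 3) = κ * ℓ ^ 3 := by
      rw [hρ]
      field_simp
    linarith
  have herrO : C * (offCount δ 2 y : ℝ) ≤ κ * ℓ ^ 3 := by
    have ho0 : (0 : ℝ) ≤ offCount δ 2 y := Nat.cast_nonneg _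
    have h1 : C * (offCount δ 2 y : ℝ) ≤ Cp * (offCount δ 2 y : ℝ) := mul_le_mul_of_nonneg_right hCle ho0
    have h2 : Cp * (offCount δ 2 y : ℝ) ≤ Cp * (Λ * ℓ ^ 2) := mul_le_mul_of_nonneg_left hoffN hCp0
    have h4 : Cp * Λ ≤ κ * ℓ := by
      have h5 := hℓMo
      rw [hMo, div_le_iff₀ hκpos] at h5
      linarith
    have hl2 : (0 : ℝ) ≤ ℓ ^ 2 := by positivity
    nlinarith [mul_le_mul_of_nonneg_right h4 hl2]
  have hmain : 7 * κ * ℓ ^ 3 ≤ c * (n : ℝ) ^ 3 := by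
    have hl3 : ℓ ^ 3 ≤ (2 * (n * s)) ^ 3 := pow_le_pow_left₀ hℓpos.le hℓns 3
    have h1 : 7 * κ * ℓ ^ 3 ≤ 7 * κ * (2 * (n * s)) ^ 3 := mul_le_mul_of_nonneg_left hl3 (by positivity)
    have h2 : 7 * κ * (2 * (n * s)) ^ 3 = c * (n : ℝ) ^ 3 := by
      rw [hκ]
      field_simp
      ring
    linarith
  -- assemble
  refine ⟨ℓ, hℓ₀ℓ, o, F, hFcoe, ?_⟩
  rw [hFcard, hU]
  have hEe : groundStateEnergy lennardJones 3 N ≤ N * e + ε * N := by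
    have := hE
    linarith
  have hl30 : (0 : ℝ) ≤ ℓ ^ 3 := by positivity
  have hκκ : κ' * ℓ ^ 3 ≤ κ * ℓ ^ 3 := mul_le_mul_of_nonneg_right hκ'le hl30
  have hGn : 0 ≤ dilGain y + shGain u y := add_nonneg (dilGain_nonneg y) (shGain_nonneg u y)
  -- ### NEW (g40): the case split on the chunk's stress gain
  by_cases hbig : Cp * (dilGain y + shGain u y) ≤ 2 * κ * ℓ ^ 3
  · -- small stress gain: the rebate is one more budget item (`2κℓ³`) and the census prices the chunk as before
    have herrG : C * (dilGain y + shGain u y) ≤ 2 * κ * ℓ ^ 3 := (mul_le_mul_of_nonneg_right hCle hGn).trans hbig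
    have hcbad : c * (n : ℝ) ^ 3 - c * (chargedCount y : ℝ) ≤ c * (badCount a 0 y : ℝ) := by
      have := mul_le_mul_of_nonneg_left (show (n : ℝ) ^ 3 - chargedCount y ≤ badCount a 0 y by linarith) hc.le
      linarith
    have herr3' : c * (chargedCount y : ℝ) + Cp * (chargedCount y : ℝ) ≤ κ * ℓ ^ 3 := by linarith
    linarith [hEe, hG, herr0, herr1, herr2, herr3', herrO, hmain, hcbad, herrG, hκκ]
  · -- large stress gain: the chunk is strained by the competitor bounds themselves
    have hlt : 2 * κ * ℓ ^ 3 < Cp * (dilGain y + shGain u y) := lt_of_not_ge hbig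
    have hlt' : C₁ * (4 * κ' * ℓ ^ 3) < C₁ * (dilGain y + shGain u y) := by
      have h1 : Cp * (dilGain y + shGain u y) ≤ C₁ * (dilGain y + shGain u y) := mul_le_mul_of_nonneg_right hCpC₁ hGn
      have h2 : C₁ * (4 * κ' * ℓ ^ 3) = 2 * κ * ℓ ^ 3 := by rw [hκC]; ring
      linarith
    have hG4 : 4 * κ' * ℓ ^ 3 < dilGain y + shGain u y := lt_of_mul_lt_mul_left hlt' hC₁pos.le
    have hk3 : 0 ≤ κ' * ℓ ^ 3 := mul_nonneg hκ'pos.le hl30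
    by_cases hd : 2 * κ' * ℓ ^ 3 < dilGain y
    · -- dilation: `E(N) + dilGain y ≤ 𝓔(y)` (exact homothety identity)
      have hD := groundStateEnergy_add_dilGain_le hy
      linarith [hD, hd, hk3]
    · -- shear: `N e⋆ + shGain u y ≤ 𝓔(y)` (directional charge), converted by `E(N) ≤ N(e⋆ + ε)`
      have hd' : dilGain y ≤ 2 * κ' * ℓ ^ 3 := le_of_not_gt hd
      have hs : 2 * κ' * ℓ ^ 3 < shGain u y := by linarith
      have hS := floor_add_shGain_le hy hu
      rw [← he] at hS
      linarith [hEe, herr2, hS, hs]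

end Summit.AtomisticToContinuum.Crystallization.Theorems.OverbindingBudgetBalancedCensus
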